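import Summits.BirchSwinnertonDyer.Rank1Residual.X11b.HalvesReceptacle
import Literature.NumberTheory.LFunctions.DworkRationalitySplittingSeries
import Mathlib.NumberTheory.Basic
import Mathlib.Algebra.CharP.Lemmas
import Mathlib.FieldTheory.Finite.Basic
import Mathlib.Analysis.SpecificLimits.Basic
import HarnessLib

/-!
# X11b — structure of the tree's `R₀ = unrIntegers p ⊂ ℂ_p`, I: Frobenius congruence, TEICHMÜLLER
# limits, division by `p`, and DISCRETENESS (`‖x‖ ∈ p^{−ℕ}` for `x ∈ R₀ ∖ 0`) — every `p`

HONEST FRAMING (cell `b2b-bsdres`, run/shared/lean/b2b/bsd-rank1-residual/, verbatim in every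
file): the goal of the cell is to DELETE the COMBINATION-SHAPED residual classes of the
Birch–Swinnerton-Dyer formula for ALL analytic-rank `≤ 1` elliptic curves over `ℚ` — "full BSD
formula for every rank `≤ 1` curve in class `C`" assembled STRICTLY from published theorems — so
that the rank-`≤ 1` remainder becomes exactly the CONSTRUCTION-SHAPED classes, which are TYPED
(missing-input `Prop`s), NOT attempted. This is not "finishing BSD". Sub-cell
`b2b-bsdres-multr1-p1` (X11b, route R1, gen 24); THEOREMS ONLY (no definition, no named fact, no
`sorry`); elementary algebra and `p`-adic analysis about the Literature definition
`unrIntegers p := (Subring.closure {prime-to-p roots of unity in ℂ_p}).topologicalClosure`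
("`R₀ = 𝒪(\widehat{ℚ_p^ur}) = W(𝔽̄_p)`", Castella 2018 §3); nothing about any curve. It supplies the
input (U-a) named by `KummerTwistIntersectionPadic.lean` / DESCENT-NOTE §2′ — discreteness of `R₀` —
from the tree's definition, with no unramifiedness theory: only the congruence
`z^{p^f} ≡ z (mod p)`.

## What this file proves (`𝓐 := Subring.closure {ζ : ζ^m = 1, p ∤ m}`, so `R₀ = closure 𝓐`)

* §1 FROBENIUS CONGRUENCE (`R1.exists_frobCong_of_mem_rootsSubring`): every `z ∈ 𝓐` satisfies
  `p ∣ z^{p^f} − z` in `𝓐` for some `f > 0` — generators `η^{p^{φ(m)}} = η` (Euler), and the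
  property is stable under `+` (freshman's dream `exists_add_pow_prime_pow_eq`), `·`, `−1`.
* §2 TEICHMÜLLER LIMIT (`R1.exists_teichmuller_limit`, `R1.exists_teichmuller_digit`): then
  `z^{p^{fn}}` is Cauchy (lifting the exponent, `dvd_sub_pow_of_dvd_sub`), its limit `t ∈ R₀` has
  `t^{p^f} = t` (so `t = 0` or `‖t‖ = 1`) and `(z − t)/p ∈ R₀`: every `z ∈ 𝓐` is `t + p·b` with
  `b ∈ R₀`.
* §3 DIVISION AND DISCRETENESS: `y ∈ 𝓐`, `‖y‖ < 1 ⟹ y/p ∈ R₀` (the digit `t` must be `0`); by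
  density the same for `y ∈ R₀` (`R1.div_p_mem_unrIntegers`), hence `‖y‖ < 1 ⟹ ‖y‖ ≤ p⁻¹`
  (`R1.norm_le_inv_of_norm_lt_one`) and, by induction, **`R1.exists_norm_eq_inv_pow`**: every
  `x ∈ R₀ ∖ {0}` has `‖x‖ = p^{−n}` with `x/p^n ∈ R₀` (`n ∈ ℕ`).

Part II (`UnrIntegersValuationRing.lean`): units, `R₀` = valuation ring of `Frac R₀`, `Frac R₀`
discretely valued, no `ζ_p` in `Frac R₀` for odd `p`, and the twist-intersection lemma over
`Frac R₀`.

References: [Castella2018] §3 (p. 9) (the ring `R₀`); [Cassels1986] J. W. S. Cassels, *Local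
Fields*, Ch. 4 and Ch. 6 (Teichmüller representatives; unramified extensions) — the statements
are folklore; the proofs here are self-contained from the tree's definition of `unrIntegers`.
-/

noncomputable section

open scoped Classical Topology

open Filter Literature.NumberTheory.EllipticCurves
open Literature.NumberTheory.LFunctions.Dwork (norm_natCast_p_padicComplex)

namespace Summit.BirchSwinnertonDyer.Rank1Residual.X11b

/-! ### §1 The Frobenius congruence `z^{p^f} ≡ z (mod p)` in a commutative ring -/

section Frobenius

variable {R : Type*} [CommRing R] {p : ℕ} [hp : Fact p.Prime]

omit hp in
/-- If `p ∣ z^{p^f} − z` then `p ∣ z^{p^{fn}} − z` for every `n` (iterate, using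
`a − b ∣ a^N − b^N`). [folklore] -/
theorem R1.dvd_pow_pow_mul_sub_of_dvd {z : R} {f : ℕ} (h : (p : R) ∣ z ^ p ^ f - z) (n : ℕ) :
    (p : R) ∣ z ^ p ^ (f * n) - z := by
  induction n with
  | zero => simp
  | succ n ih =>
    have h1 : (p : R) ∣ (z ^ p ^ (f * n)) ^ p ^ f - z ^ p ^ f :=
      dvd_trans ih (sub_dvd_pow_sub_pow _ _ _)
    have : z ^ p ^ (f * (n + 1)) = (z ^ p ^ (f * n)) ^ p ^ f := by
      rw [← pow_mul, ← pow_add, Nat.mul_succ]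
    rw [this]
    have := dvd_add h1 h
    rwa [sub_add_sub_cancel] at this

omit hp in
/-- The Frobenius congruence is stable under products: from `p ∣ x^{p^f} − x`, `p ∣ y^{p^g} − y`
(`f, g > 0`) get `p ∣ (xy)^{p^{fg}} − xy`. [folklore] -/
theorem R1.frobCong_mul {x y : R} {f g : ℕ} (hf : 0 < f) (hg : 0 < g)
    (hx : (p : R) ∣ x ^ p ^ f - x) (hy : (p : R) ∣ y ^ p ^ g - y) :
    ∃ h : ℕ, 0 < h ∧ (p : R) ∣ (x * y) ^ p ^ h - x * y := by
  refine ⟨f * g, Nat.mul_pos hf hg, ?_⟩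
  have hx' := R1.dvd_pow_pow_mul_sub_of_dvd hx g
  have hy' := R1.dvd_pow_pow_mul_sub_of_dvd hy f
  rw [Nat.mul_comm g f] at hy'
  have : (x * y) ^ p ^ (f * g) - x * y =
      x ^ p ^ (f * g) * (y ^ p ^ (f * g) - y) + (x ^ p ^ (f * g) - x) * y := by ring
  rw [this]
  exact dvd_add (dvd_mul_of_dvd_right hy' _) (dvd_mul_of_dvd_left hx' _)

/-- The Frobenius congruence is stable under sums ("freshman's dream" modulo `p`):
`(x + y)^{p^N} = x^{p^N} + y^{p^N} + p·(…)`. [folklore] -/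
theorem R1.frobCong_add {x y : R} {f g : ℕ} (hf : 0 < f) (hg : 0 < g)
    (hx : (p : R) ∣ x ^ p ^ f - x) (hy : (p : R) ∣ y ^ p ^ g - y) :
    ∃ h : ℕ, 0 < h ∧ (p : R) ∣ (x + y) ^ p ^ h - (x + y) := by
  refine ⟨f * g, Nat.mul_pos hf hg, ?_⟩
  have hx' := R1.dvd_pow_pow_mul_sub_of_dvd hx g
  have hy' := R1.dvd_pow_pow_mul_sub_of_dvd hy f
  rw [Nat.mul_comm g f] at hy'
  obtain ⟨r, hr⟩ := exists_add_pow_prime_pow_eq hp.out x y (f * g)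
  have : (x + y) ^ p ^ (f * g) - (x + y) =
      (x ^ p ^ (f * g) - x) + (y ^ p ^ (f * g) - y) + p * (x * y * r) := by
    rw [hr]; ring
  rw [this]
  exact dvd_add (dvd_add hx' hy') (dvd_mul_right _ _)

/-- `−1` satisfies the Frobenius congruence: `(−1)^p + 1 ∈ {0, 2}` is divisible by `p`.
[folklore] -/
theorem R1.frobCong_neg_one : ∃ h : ℕ, 0 < h ∧ (p : R) ∣ (-1 : R) ^ p ^ h - (-1) := by
  refine ⟨1, one_pos, ?_⟩
  rw [pow_one]
  rcases hp.out.eq_two_or_odd' with rfl | hodd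
  · exact ⟨1, by norm_num⟩
  · rw [hodd.neg_one_pow, sub_self]
    exact dvd_zero _

/-- A root of unity of order prime to `p` satisfies `η^{p^f} = η` with `f = φ(m) > 0` (Euler).
[folklore] -/
theorem R1.pow_pow_totient_eq_of_pow_eq_one {η : R} {m : ℕ} (hpm : ¬ p ∣ m)
    (hη : η ^ m = 1) : η ^ p ^ Nat.totient m = η := by
  have hcop : Nat.Coprime p m := (Nat.Prime.coprime_iff_not_dvd hp.out).mpr hpm
  have hmod : p ^ Nat.totient m ≡ 1 [MOD m] := Nat.ModEq.pow_totient hcop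
  obtain ⟨k, hk⟩ : ∃ k, p ^ Nat.totient m = m * k + 1 := by
    have h1 : 1 ≤ p ^ Nat.totient m := Nat.one_le_pow _ _ hp.out.pos
    have hdvd : m ∣ p ^ Nat.totient m - 1 :=
      (Nat.modEq_iff_dvd' h1).mp hmod.symm
    obtain ⟨k, hk⟩ := hdvd
    exact ⟨k, by omega⟩
  rw [hk, pow_succ, pow_mul, hη, one_pow, one_mul]

/-- **Frobenius congruence in `ℤ[μ_{p'}] ⊂ R₀`.** Every element `x` of the subring of `ℂ_p`
generated by the roots of unity of order prime to `p` satisfies `p ∣ x^{p^f} − x` IN `R₀` (indeed in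
that subring) for some `f > 0` (generators: `η^{p^{φ(m)}} = η`; closure under `+`, `·`, `−` by the
three lemmas above). [folklore] -/
theorem R1.exists_frobCong_of_mem_rootsSubring {x : ℂ_[p]}
    (hx : x ∈ Subring.closure {ζ : ℂ_[p] | ∃ m : ℕ, 0 < m ∧ ¬ p ∣ m ∧ ζ ^ m = 1}) :
    ∃ f : ℕ, 0 < f ∧ (p : unrIntegers p) ∣
      (⟨x, Subring.le_topologicalClosure _ hx⟩ : unrIntegers p) ^ p ^ f -
        ⟨x, Subring.le_topologicalClosure _ hx⟩ := by
  induction hx using Subring.closure_induction with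
  | mem x hx =>
    obtain ⟨m, hm, hpm, hxm⟩ := hx
    refine ⟨Nat.totient m, Nat.totient_pos.mpr hm, ?_⟩
    have hxm' : (⟨x, Subring.le_topologicalClosure _ (Subring.subset_closure ⟨m, hm, hpm, hxm⟩)⟩ :
        unrIntegers p) ^ m = 1 :=
      Subtype.ext (by simpa using hxm)
    rw [R1.pow_pow_totient_eq_of_pow_eq_one hpm hxm', sub_self]
    exact dvd_zero _
  | zero =>
    have e : (⟨0, Subring.le_topologicalClosure _ (Subring.zero_mem _)⟩ : unrIntegers p) = 0 := rfl
    rw [e]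
    exact ⟨1, one_pos, by rw [zero_pow (pow_ne_zero _ hp.out.ne_zero), sub_self]; exact dvd_zero _⟩
  | one =>
    have e : (⟨1, Subring.le_topologicalClosure _ (Subring.one_mem _)⟩ : unrIntegers p) = 1 := rfl
    rw [e]
    exact ⟨1, one_pos, by rw [one_pow, sub_self]; exact dvd_zero _⟩
  | add x y hx hy ihx ihy =>
    obtain ⟨f, hf, hfx⟩ := ihx
    obtain ⟨g, hg, hgy⟩ := ihy
    have e : (⟨x + y, Subring.le_topologicalClosure _ (add_mem hx hy)⟩ : unrIntegers p) =
        ⟨x, Subring.le_topologicalClosure _ hx⟩ + ⟨y, Subring.le_topologicalClosure _ hy⟩ :=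
      Subtype.ext (by simp)
    rw [e]
    exact R1.frobCong_add hf hg hfx hgy
  | neg x hx ihx =>
    obtain ⟨f, hf, hfx⟩ := ihx
    obtain ⟨g, hg, hg1⟩ := (R1.frobCong_neg_one (R := unrIntegers p) (p := p))
    obtain ⟨h, hh, hdvd⟩ := R1.frobCong_mul hg hf hg1 hfx
    rw [neg_one_mul] at hdvd
    have e : (⟨-x, Subring.le_topologicalClosure _ (neg_mem hx)⟩ : unrIntegers p) =
        -⟨x, Subring.le_topologicalClosure _ hx⟩ := Subtype.ext (by simp)
    rw [e]
    exact ⟨h, hh, hdvd⟩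
  | mul x y hx hy ihx ihy =>
    obtain ⟨f, hf, hfx⟩ := ihx
    obtain ⟨g, hg, hgy⟩ := ihy
    have e : (⟨x * y, Subring.le_topologicalClosure _ (mul_mem hx hy)⟩ : unrIntegers p) =
        ⟨x, Subring.le_topologicalClosure _ hx⟩ * ⟨y, Subring.le_topologicalClosure _ hy⟩ :=
      Subtype.ext (by simp)
    rw [e]
    exact R1.frobCong_mul hf hg hfx hgy

end Frobenius

/-! ### §2 Teichmüller limits in `R₀` -/

section Teichmuller

variable {p : ℕ} [hp : Fact p.Prime]

/-- Divisibility in `R₀` bounds norms: `d ∣ w ⟹ ‖w‖ ≤ ‖d‖` (`‖R₀‖ ≤ 1`). [folklore] -/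
theorem R1.norm_le_of_dvd_unrIntegers {d w : unrIntegers p} (h : d ∣ w) :
    ‖(w : ℂ_[p])‖ ≤ ‖(d : ℂ_[p])‖ := by
  obtain ⟨e, rfl⟩ := h
  rw [Subring.coe_mul, norm_mul]
  exact mul_le_of_le_one_right (norm_nonneg _) (Halves.norm_coe_unrIntegers_le_one p e)

/-- **Teichmüller limit.** For `z ∈ R₀` with `p ∣ z^{p^f} − z` in `R₀` (`f > 0`), the sequence
`z^{p^{fn}}` converges in `ℂ_p` (it is `p`-adically Cauchy by lifting the exponent:
`p^{fn+1} ∣ z^{p^{f(n+1)}} − z^{p^{fn}}`) to a `t ∈ R₀` with `t^{p^f} = t`, and `(z − t)/p ∈ R₀`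
(each `(z^{p^{fn}} − z)/p` lies in `R₀`, which is closed). [folklore] -/
theorem R1.exists_teichmuller_limit (z : unrIntegers p) {f : ℕ} (hf : 0 < f)
    (hz : (p : unrIntegers p) ∣ z ^ p ^ f - z) :
    ∃ t : ℂ_[p], Tendsto (fun n : ℕ ↦ (z : ℂ_[p]) ^ p ^ (f * n)) atTop (𝓝 t) ∧
      t ∈ unrIntegers p ∧ t ^ p ^ f = t ∧ ((z : ℂ_[p]) - t) / p ∈ unrIntegers p := by
  have hp' : p.Prime := hp.out
  have hp0 : (p : ℂ_[p]) ≠ 0 := by exact_mod_cast hp'.ne_zero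
  have hnp : ‖(p : ℂ_[p])‖ < 1 := by
    rw [norm_natCast_p_padicComplex]
    exact inv_lt_one_of_one_lt₀ (by exact_mod_cast hp'.one_lt)
  set u : ℕ → ℂ_[p] := fun n ↦ (z : ℂ_[p]) ^ p ^ (f * n) with hu_def
  -- lifting the exponent: `‖u (n+1) - u n‖ ≤ ‖p‖^(f n + 1) ≤ ‖p‖ * ‖p‖^n`
  have hstep : ∀ n, dist (u n) (u (n + 1)) ≤ ‖(p : ℂ_[p])‖ * ‖(p : ℂ_[p])‖ ^ n := by
    intro n
    have hdvd : ((p : unrIntegers p) ^ (f * n + 1)) ∣ (z ^ p ^ f) ^ p ^ (f * n) - z ^ p ^ (f * n) :=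
      dvd_sub_pow_of_dvd_sub hz (f * n)
    have hnorm := R1.norm_le_of_dvd_unrIntegers hdvd
    rw [dist_comm, dist_eq_norm]
    have e : u (n + 1) - u n =
        (((z ^ p ^ f) ^ p ^ (f * n) - z ^ p ^ (f * n) : unrIntegers p) : ℂ_[p]) := by
      simp only [hu_def]
      push_cast
      ring
    rw [e]
    refine hnorm.trans ?_
    rw [Subring.coe_pow, Subring.coe_natCast, norm_pow, ← pow_succ']
    exact pow_le_pow_of_le_one (norm_nonneg _) hnp.le (by nlinarith [hf])
  have hcauchy : CauchySeq u := cauchySeq_of_le_geometric _ _ hnp hstep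
  obtain ⟨t, ht⟩ := cauchySeq_tendsto_of_complete hcauchy
  have humem : ∀ n, u n ∈ unrIntegers p := fun n ↦ Subring.pow_mem _ z.2 _
  have htmem : t ∈ unrIntegers p :=
    isClosed_unrIntegers.mem_of_tendsto ht (Eventually.of_forall humem)
  have htpow : t ^ p ^ f = t := by
    have h1 : Tendsto (fun n ↦ u (n + 1)) atTop (𝓝 t) := ht.comp (tendsto_add_atTop_nat 1)
    have h2 : Tendsto (fun n ↦ u n ^ p ^ f) atTop (𝓝 (t ^ p ^ f)) := ht.pow _
    have e : (fun n ↦ u (n + 1)) = fun n ↦ u n ^ p ^ f := by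
      funext n
      simp only [hu_def]
      rw [← pow_mul, ← pow_add, mul_add_one]
    rw [e] at h1
    exact tendsto_nhds_unique h2 h1
  refine ⟨t, ht, htmem, htpow, ?_⟩
  -- `(u n - z)/p ∈ R₀`, and it tends to `(t - z)/p`
  have hquot : ∀ n, (u n - z) / p ∈ unrIntegers p := by
    intro n
    obtain ⟨c, hc⟩ := R1.dvd_pow_pow_mul_sub_of_dvd hz n
    have e : u n - z = (p : ℂ_[p]) * c := by
      have := congrArg (fun w : unrIntegers p ↦ (w : ℂ_[p])) hc
      simpa [hu_def] using this
    rw [e, mul_div_cancel_left₀ _ hp0]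
    exact c.2
  have hlim : Tendsto (fun n ↦ (u n - z) / p) atTop (𝓝 ((t - z) / p)) :=
    (ht.sub_const _).div_const _
  have hmem : (t - (z : ℂ_[p])) / p ∈ unrIntegers p :=
    isClosed_unrIntegers.mem_of_tendsto hlim (Eventually.of_forall hquot)
  have e : ((z : ℂ_[p]) - t) / p = -((t - z) / p) := by ring
  rw [e]
  exact neg_mem hmem

/-- If `t^{p^f} = t` (`f > 0`) in `ℂ_p` then `t = 0` or `‖t‖ = 1` (`t^{p^f − 1} = 1`). [folklore] -/
theorem R1.eq_zero_or_norm_eq_one_of_pow_eq {t : ℂ_[p]} {f : ℕ} (hf : 0 < f)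
    (htpow : t ^ p ^ f = t) : t = 0 ∨ ‖t‖ = 1 := by
  rcases eq_or_ne t 0 with h0 | h0
  · exact Or.inl h0
  · right
    have hN : 0 < p ^ f - 1 := by
      have : 2 ≤ p ^ f := (Nat.pow_le_pow_left hp.out.two_le f).trans' (by
        calc 2 = 2 ^ 1 := by norm_num
          _ ≤ 2 ^ f := Nat.pow_le_pow_right (by norm_num) hf)
      omega
    have h1 : t ^ (p ^ f - 1) = 1 := by
      have : t * (t ^ (p ^ f - 1) - 1) = 0 := by
        rw [mul_sub, mul_one, ← pow_succ', Nat.sub_add_cancel (by omega), htpow, sub_self]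
      rcases mul_eq_zero.mp this with h | h
      · exact absurd h h0
      · exact sub_eq_zero.mp h
    have h2 : ‖t‖ ^ (p ^ f - 1) = 1 := by rw [← norm_pow, h1, norm_one]
    exact (pow_eq_one_iff_of_nonneg (norm_nonneg t) hN.ne').mp h2

/-- **Teichmüller digit.** Every `z ∈ ℤ[μ_{p'}]` is `t + p·b` with `t ∈ R₀`, `t = 0` or `‖t‖ = 1`,
and `b ∈ R₀`. [folklore] -/
theorem R1.exists_teichmuller_digit {z : ℂ_[p]}
    (hz : z ∈ Subring.closure {ζ : ℂ_[p] | ∃ m : ℕ, 0 < m ∧ ¬ p ∣ m ∧ ζ ^ m = 1}) :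
    ∃ t ∈ unrIntegers p, (t = 0 ∨ ‖t‖ = 1) ∧ (z - t) / p ∈ unrIntegers p := by
  obtain ⟨f, hf, hdvd⟩ := R1.exists_frobCong_of_mem_rootsSubring hz
  obtain ⟨t, -, htmem, htpow, hb⟩ := R1.exists_teichmuller_limit _ hf hdvd
  exact ⟨t, htmem, R1.eq_zero_or_norm_eq_one_of_pow_eq hf htpow, hb⟩

end Teichmuller

/-! ### §3 Division by `p` and discreteness of `R₀` -/

section Discrete

variable {p : ℕ} [hp : Fact p.Prime]

/-- **Division by `p` in `ℤ[μ_{p'}]`.** If `y ∈ ℤ[μ_{p'}]` has `‖y‖ < 1` then `y/p ∈ R₀` (its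
Teichmüller digit is `0`: a digit of norm `1` would force `‖y‖ = 1`). [folklore] -/
theorem R1.div_p_mem_unrIntegers_of_mem_rootsSubring {y : ℂ_[p]}
    (hy : y ∈ Subring.closure {ζ : ℂ_[p] | ∃ m : ℕ, 0 < m ∧ ¬ p ∣ m ∧ ζ ^ m = 1})
    (hy1 : ‖y‖ < 1) : y / p ∈ unrIntegers p := by
  obtain ⟨t, htmem, ht, hb⟩ := R1.exists_teichmuller_digit hy
  rcases ht with rfl | ht1
  · simpa using hb
  · exfalso
    have hp0 : (p : ℂ_[p]) ≠ 0 := by exact_mod_cast hp.out.ne_zero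
    have hpb : ‖(p : ℂ_[p]) * ((y - t) / p)‖ < 1 := by
      rw [norm_mul, norm_natCast_p_padicComplex]
      have hb1 := Halves.norm_le_one_of_mem_unrIntegers p hb
      have : (p : ℝ)⁻¹ < 1 := inv_lt_one_of_one_lt₀ (by exact_mod_cast hp.out.one_lt)
      calc (p : ℝ)⁻¹ * ‖(y - t) / ↑p‖ ≤ (p : ℝ)⁻¹ * 1 := by gcongr
        _ < 1 := by simpa using this
    have e : t = y - (p : ℂ_[p]) * ((y - t) / p) := by
      rw [mul_div_cancel₀ _ hp0]; ring
    have : ‖t‖ < 1 := by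
      rw [e]
      rw [sub_eq_add_neg]
      refine (IsUltrametricDist.norm_add_le_max _ _).trans_lt (max_lt hy1 ?_)
      rwa [norm_neg]
    exact (lt_irrefl _) (ht1 ▸ this)

/-- **Division by `p` in `R₀`.** If `y ∈ R₀` has `‖y‖ < 1` then `y/p ∈ R₀` (density of `ℤ[μ_{p'}]`,
`R₀` closed). [folklore] -/
theorem R1.div_p_mem_unrIntegers {y : ℂ_[p]} (hy : y ∈ unrIntegers p) (hy1 : ‖y‖ < 1) :
    y / p ∈ unrIntegers p := by
  have hy' : y ∈ closure ((Subring.closure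
      {ζ : ℂ_[p] | ∃ m : ℕ, 0 < m ∧ ¬ p ∣ m ∧ ζ ^ m = 1} : Subring ℂ_[p]) : Set ℂ_[p]) := hy
  obtain ⟨a, ha, hlim⟩ := mem_closure_iff_seq_limit.mp hy'
  have hev : ∀ᶠ k in atTop, a k / p ∈ unrIntegers p := by
    have h1 : ∀ᶠ k in atTop, ‖a k - y‖ < 1 := by
      have := (tendsto_iff_norm_sub_tendsto_zero.mp hlim).eventually (gt_mem_nhds one_pos)
      exact this
    filter_upwards [h1] with k hk
    refine R1.div_p_mem_unrIntegers_of_mem_rootsSubring (ha k) ?_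
    have e : a k = y + (a k - y) := by ring
    rw [e]
    exact (IsUltrametricDist.norm_add_le_max _ _).trans_lt (max_lt hy1 hk)
  exact isClosed_unrIntegers.mem_of_tendsto (hlim.div_const _) hev

/-- In `R₀`, `‖y‖ < 1 ⟹ ‖y‖ ≤ p⁻¹` (no norms strictly between `p⁻¹` and `1`). [folklore] -/
theorem R1.norm_le_inv_of_norm_lt_one {y : ℂ_[p]} (hy : y ∈ unrIntegers p) (hy1 : ‖y‖ < 1) :
    ‖y‖ ≤ (p : ℝ)⁻¹ := by
  have hp0 : (p : ℂ_[p]) ≠ 0 := by exact_mod_cast hp.out.ne_zero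
  have h := Halves.norm_le_one_of_mem_unrIntegers p (R1.div_p_mem_unrIntegers hy hy1)
  rw [norm_div, norm_natCast_p_padicComplex,
    div_le_one (inv_pos.mpr (by exact_mod_cast hp.out.pos))] at h
  exact h

/-- **`R₀` is discretely valued**: every non-zero `x ∈ R₀` has `‖x‖ = p^{−n}` for some `n ∈ ℕ`
(and then `x / p^n ∈ R₀` has norm `1`). [folklore] -/
theorem R1.exists_norm_eq_inv_pow {x : ℂ_[p]} (hx : x ∈ unrIntegers p) (hx0 : x ≠ 0) :
    ∃ n : ℕ, ‖x‖ = (p : ℝ)⁻¹ ^ n ∧ x / (p : ℂ_[p]) ^ n ∈ unrIntegers p := by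
  have hp' : p.Prime := hp.out
  have hpinv : (p : ℝ)⁻¹ < 1 := inv_lt_one_of_one_lt₀ (by exact_mod_cast hp'.one_lt)
  have hpinv0 : 0 < (p : ℝ)⁻¹ := inv_pos.mpr (by exact_mod_cast hp'.pos)
  -- induction on `N` with `p^{-(N+1)} < ‖x‖`
  have key : ∀ N : ℕ, ∀ x : ℂ_[p], x ∈ unrIntegers p → (p : ℝ)⁻¹ ^ (N + 1) < ‖x‖ →
      ∃ n : ℕ, ‖x‖ = (p : ℝ)⁻¹ ^ n ∧ x / (p : ℂ_[p]) ^ n ∈ unrIntegers p := by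
    intro N
    induction N with
    | zero =>
      intro x hx hlt
      refine ⟨0, ?_, by simpa using hx⟩
      rw [pow_zero]
      refine le_antisymm (Halves.norm_le_one_of_mem_unrIntegers p hx) ?_
      by_contra h
      have := R1.norm_le_inv_of_norm_lt_one hx (not_le.mp h)
      rw [zero_add, pow_one] at hlt
      exact (lt_irrefl _) (hlt.trans_le this)
    | succ N ih =>
      intro x hx hlt
      by_cases h1 : ‖x‖ < 1
      · have hx' := R1.div_p_mem_unrIntegers hx h1
        have hlt' : (p : ℝ)⁻¹ ^ (N + 1) < ‖x / p‖ := by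
          rw [norm_div, norm_natCast_p_padicComplex, lt_div_iff₀ hpinv0, ← pow_succ]
          exact hlt
        obtain ⟨n, hn, hmem⟩ := ih (x / p) hx' hlt'
        refine ⟨n + 1, ?_, ?_⟩
        · rw [norm_div, norm_natCast_p_padicComplex, div_eq_iff hpinv0.ne'] at hn
          rw [hn, pow_succ]
        · rwa [pow_succ', ← div_div]
          -- `x / (p * p^n) = x / p / p^n`
      · refine ⟨0, ?_, by simpa using hx⟩
        rw [pow_zero]
        exact le_antisymm (Halves.norm_le_one_of_mem_unrIntegers p hx) (not_lt.mp h1)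
  obtain ⟨N, hN⟩ := exists_pow_lt_of_lt_one (norm_pos_iff.mpr hx0) hpinv
  exact key N x hx ((pow_le_pow_of_le_one hpinv0.le hpinv.le (Nat.le_succ N)).trans_lt hN)

end Discrete

end Summit.BirchSwinnertonDyer.Rank1Residual.X11b

end
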